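import Summits.QuantumFields.YangMills.Theorems.BalabanUVNodesN13DensityBelowIteratedTransportOfDeadSelAtRecord13CoPH
import Summits.QuantumFields.YangMills.Theorems.BalabanUVNodesN13EndStatementBOfTRowAndPieceBoundsAtRecord13SepCoPH

/-!
# BalabanUVNodes ∕ N13 — N13's DAG NODE, K1⁷'s (B) AT ITS LITERAL DATUM, [III] COR. 3 AND THE ENGINE ROW `hUV` RE-PRICED BY ONE EXPANSION-FREE STATEMENT: under the tree's selector law (ii) the
# (UV₁₃) upper half follows from an everywhere ULTRAVIOLET-STABILITY BOUND ON THE ITERATED TRANSPORT OF `ρ₀` (the `k`-fold block-averaged Wilson–Gibbs density, p616879) — the lower half from (L2ˢ)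
# as before (Track A, DAG node N13 = [B16]; cluster K1 — K1⁷ `StabilityBAtRecordR13SepCoPH` = stmt-QuantumFields-20542, helper; seat `pub-ymgap-dag-n13-w3` g3; the third pricing of F3 ∕ F6
# (p604459 ∕ p610463); 2026-08-28; count-neutral)

HONEST FRAMING.  Count-neutral BY-NAME JUNCTION; nothing of Bałaban's is asserted or refuted.  F3 priced N13's node by (U1_Z) + (L2ˢ), F6 by the per-step rows of the majorant tower + (L2ˢ);
p615170 ∕ p613238 ∕ p616879 showed that under the tree's selector law (ii) AS TYPED (`hdead` — the node files' own hypothesis) the density of record lies below the ITERATED one-step transport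
`I_k = (T_{k−1}∘⋯∘T_0)(ρ₀)` at every field (and equals it a.e. under laws (i)(ii)).  THIS FILE substitutes that into F3's four statements: (§1) the engines' row `hUV` ⟸ law (ii) on the
windowed runs' levels, the MEASURABILITY of the history terms (K0c's theorem under (H-U); displayed), ONE analytic row «`I_k(V) ≤ exp(ep(g_k)·|T₁^{(k)}|)` at every field, `k ≤ K`» — the
EXPANSION-FREE ultraviolet-stability bound for the block-averaged Gibbs density (`hIUV`) —, (L2ˢ) and `hε hε3 hε2`; (§2) [III] Cor. 3 «with e±» ∕ `Cor3_250`; (§3) K1⁷'s (B) at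
`datumOfRecord₁₃SepCoPH θ h` from Theorem 1 there, and from N11's T-row + the selector laws (p583899 — the SAME `hdead` serving Theorem 1's 𝐑-leaf and the upper half); (§4) N13's DAG
NODE `Dag.B16_main (leavesP w P)` ⟸ admissibility ∧ signs ∧ selector laws (i)(ii) ∧ `hIUV` ∧ measurability ∧ (L2ˢ) ∧ ε-conditions.  WHAT IS DISPLAYED AND WHERE IT SITS IN PRINT (LOCATED,
by name): `hIUV` is NOT a statement print proves in d = 4 — [B16] ∕ [IV] reach (2.50) for the 𝐑-RENORMALISED densities through the history-mixing 𝐑 of [IV] ((0.3) with nontrivial `Z′`;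
abstract, p.175), which the tree's law (ii) does not exercise (p615170: 𝐑 of record never mixes histories); so at the parameters the node files cover, N13's upper half IS unrenormalised UV
stability of the averaged density — the honest residual; (L2ˢ) is [III] Thm 2 ∕ (2.49) at the all-small history; N11's T-row and the selector laws as in F3.  (U1) NOT proved; Cor. 3 NOT
proved; N13 NOT discharged; K0⁷ ∕ K1⁷ NOT closed; counts unmoved (discharged 5∕27 · Track A 5∕28).  ONE finite four-torus programme at fixed `ε = L^{−K}`; R4 closes the conditional
finite-𝕋⁴ rung `BalabanLadder.UV` only — the Yang–Mills mass gap (Clay) is NOT proved by any of this; nothing continuum ∕ ℝ⁴ ∕ OS.  No `sorry`, `def`, `instance`, `notation`.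

Sources: [Balaban1988Convergent] p.245, (2.18) p.257, Thm 1 p.262, Thm 2 p.263, (2.49) + Cor. 3 (2.50) p.264, (3.1) p.264; [Balaban1989LargeFieldI] abstract, p.175, (0.2)–(0.4) p.176, (i)–(ii) p.177;
[Balaban1989LargeFieldII] Thm 1 + (0.1) pp.355–356, p.391.
-/

noncomputable section

open MeasureTheory
open scoped BigOperators Matrix.Norms.L2Operator

namespace Summit.QuantumFields.YangMills.BalabanUVNodes.N13NodeOfIteratedTransportUVAtRecord13SepCoPH

open Literature.MathematicalPhysics.QuantumFieldTheory.Balaban1983to89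
open T4Continuum Node00 B14.Eq218Concrete
open FlowStepRuns (genFlow)
open DagBinding (WorldP)
open ExpMeanLog (deltaSU)
open B16NodeKnitRecord13CoPH (uvIneq_at_record₁₃CoPH_iff)
open B14Cor3 (inInterval_of_le)
open B16RLeafRecord13SepCoPHSelLaws (thm1Printed_datumOfRecord₁₃SepCoPH_of_laws_of_selLaws)
open Summit.QuantumFields.YangMills.BalabanUVNodes.N13Cor3Repr218LeavesAtRecord13CoPH (densOfRecord₁₃_eq_sum sLaw₁₃CoPH_of_thm1)
open Summit.QuantumFields.YangMills.BalabanUVNodes.N13UVChiOffSolvableAtRecord13 (histTerm_nonneg uvLower_of_smallLocus)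
open Summit.QuantumFields.YangMills.BalabanUVNodes.N13UVRowOfUpperAndSmallLocus (hUV₁₃_of_upper_of_lowerSmallLocus)
open Summit.QuantumFields.YangMills.BalabanUVNodes.N13DensityBelowIteratedTransportOfDeadSelAtRecord13CoPH (densOfRecord₁₃_le_iterTransport_of_deadSel)

variable (F : T4Family) (N : ℕ) [NeZero N]

/-! ## §1. The engines' row `hUV` from law (ii) + the expansion-free UV bound on the iterated transport + (L2ˢ) -/

section Row

variable (θ : Stage13HParams F N) (w : WorldP)

open Classical in
/-- **★★★ THE ENGINE ROW `hUV` FROM ONE EXPANSION-FREE ROW + (L2ˢ)** (the third pricing of module 36's `hUV13`, `WorldP` letters): UPPER half at every configuration from p616879's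
`densOfRecord₁₃_le_iterTransport_of_deadSel` (law (ii) `hdead` on the run's levels, measurability of the history terms, the iterates bounded by the UV row itself) and the displayed row
`hIUV` «`I_k(V) ≤ exp(w.ep(g_k)|T₁^{(k)}|)`» — ultraviolet stability of the `k`-fold BLOCK-AVERAGED Wilson–Gibbs density (LOCATED: not print's theorem in d = 4) —; LOWER half from (L2ˢ) via
dag-n13-w1's `uvLower_of_smallLocus` inside `hUV₁₃_of_upper_of_lowerSmallLocus`.  CONDITIONAL; nothing of Bałaban's asserted. [cite: Balaban1988Convergent, Cor. 3 (2.50) p.264, (3.1) p.264; Balaban1989LargeFieldI, (0.3) p.176, (ii) p.177, p.175; Balaban1989LargeFieldII, (0.1) pp.355–356] -/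
theorem hUV₁₃CoPH_of_iterTransportUV_L2small (h : θ.Provisos₁₃CoPH F N) (hε : 0 < θ.ν.εreg) (hε3 : (143 * ((((4 + 4 : ℕ) : ℝ)) ^ 2 / 4) ^ 2) * θ.ν.εreg ≤ 1 / 3)
    (hε2 : 2 * θ.ν.εreg ≤ 2 * deltaSU (Fin N) / ((((4 + 4) * F.L : ℕ) : ℝ) ^ 2))
    (hdead : ∀ (P : B12.RunParams) j, j < P.K → ∀ a : SeqOfRecord F θ.ν θ.τ9.M (gOfRecord₁₃ F N θ.toStage13Params P) P.K (j + 1),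
      θ.ppSel P (gOfRecord₁₃ F N θ.toStage13Params P) (j + 1) a ≠ a →
      ∀ V, B15.BasicStep.fibreIntegral (fibOfSeq F θ.ν θ.τ9 P (gOfRecord₁₃ F N θ.toStage13Params P) (j + 1) a)
        (rterm (sliceOfRecord F N θ.ν θ.τ9.M P (gOfRecord₁₃ F N θ.toStage13Params P) (j + 1)
          (slotsTOfRecord F N θ.ν θ.τ9 (EOfRecord₁₃ F N θ.toStage13Params) (wOfRecord₉ F N θ.toStage9Params) θ.ppSel P (gOfRecord₁₃ F N θ.toStage13Params P) (j + 1))) a) V = 0)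
    (hmeas : ∀ (P : B12.RunParams) j, j < P.K → ∀ s : SeqOfRecord F θ.ν θ.τ9.M (gOfRecord₁₃ F N θ.toStage13Params P) P.K j,
      Measurable (fun U => chiSeqOfRecord F N θ.ν θ.τ9.M (gOfRecord₁₃ F N θ.toStage13Params P) P.K j s U *
        slotsOfRecord F N θ.ν θ.τ9 (EOfRecord₁₃ F N θ.toStage13Params) (wOfRecord₉ F N θ.toStage9Params) θ.ppSel P (gOfRecord₁₃ F N θ.toStage13Params P) j s U))
    (hIUV : ∀ P : B12.RunParams, (genFlow (betaOfRecord₁₃ F N θ.toStage13Params) P.g0).InInterval w.γ P.K → ∀ k, k ≤ P.K → ∀ V : GaugeField (F.P P.K) k (SU N),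
      Nat.rec (motive := fun j => GaugeField (F.P P.K) j (SU N) → ℝ)
        (rhoZeroOfRecord F N P.K (gOfRecord₁₃ F N θ.toStage13Params P 0) (EOfRecord₁₃ F N θ.toStage13Params P))
        (fun j I => transportOfRecord F N P.K j I) k V ≤ Real.exp (w.ep (gOfRecord₁₃ F N θ.toStage13Params P k) * (Fintype.card (Site (F.P P.K) k) : ℝ)))
    (s₀ : (P : B12.RunParams) → (k : ℕ) → (reprOfRecord₁₃ F N θ.toStage13Params P k).Adm)
    (hL2small : ∀ P : B12.RunParams, (genFlow (betaOfRecord₁₃ F N θ.toStage13Params) P.g0).InInterval w.γ P.K → ∀ k, k ≤ P.K → SLaw₁₃CoPH F N θ P k →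
      ∀ V : GaugeField (F.P P.K) k (SU N),
        (∀ p : Plaq (F.P P.K) k, ¬ IsB0 (F := F) (⟨p.src, p.μ⟩ : PBond (F.P P.K) k) → ¬ IsB0 (F := F) (⟨p.src.shift p.μ, p.ν⟩ : PBond (F.P P.K) k) →
          ¬ IsB0 (F := F) (⟨p.src.shift p.ν, p.μ⟩ : PBond (F.P P.K) k) → ¬ IsB0 (F := F) (⟨p.src, p.ν⟩ : PBond (F.P P.K) k) →
          dist1 (GaugeField.plaqHol V p) < 2 * θ.ν.εreg + 4 * θ.ε₂₉) →
        chiβOfRecord₁₃ F N θ.toStage13Params P.K (gOfRecord₁₃ F N θ.toStage13Params P) k V *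
            Real.exp (-(1 / (gOfRecord₁₃ F N θ.toStage13Params P k) ^ 2 * wilsonBGOfRecord F N θ.εbg P k V)
              - w.em (gOfRecord₁₃ F N θ.toStage13Params P k) * (Fintype.card (Site (F.P P.K) k) : ℝ)) ≤
          (reprOfRecord₁₃ F N θ.toStage13Params P k).χ (s₀ P k) V * (reprOfRecord₁₃ F N θ.toStage13Params P k).TexpA (s₀ P k) V) :
    ∀ P : B12.RunParams, (genFlow (betaOfRecord₁₃ F N θ.toStage13Params) P.g0).InInterval w.γ P.K → ∀ k, k ≤ P.K → SLaw₁₃CoPH F N θ P k →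
      ∀ U : GaugeField (F.P P.K) k (SU N),
        chiβOfRecord₁₃ F N θ.toStage13Params P.K (gOfRecord₁₃ F N θ.toStage13Params P) k U *
              Real.exp (-(1 / (gOfRecord₁₃ F N θ.toStage13Params P k) ^ 2 * wilsonBGOfRecord F N θ.toStage13Params.εbg P k U)
                - w.em (gOfRecord₁₃ F N θ.toStage13Params P k) * (Fintype.card (Site (F.P P.K) k) : ℝ)) ≤ densOfRecord₁₃ F N θ.toStage13Params P k U ∧
        densOfRecord₁₃ F N θ.toStage13Params P k U ≤ Real.exp (w.ep (gOfRecord₁₃ F N θ.toStage13Params P k) * (Fintype.card (Site (F.P P.K) k) : ℝ)) :=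
  hUV₁₃_of_upper_of_lowerSmallLocus θ h w hε hε3 hε2
    (fun P hP k hk _ U => (densOfRecord₁₃_le_iterTransport_of_deadSel F N θ P h k hk
      (fun j hj => hdead P j (lt_of_lt_of_le hj hk)) (fun j hj => ⟨_, fun V => hIUV P hP j (hj.le.trans hk) V⟩)
      (fun j hj => hmeas P j (lt_of_lt_of_le hj hk)) U).trans (hIUV P hP k hk U))
    (fun P hP k hk hS U hsmall =>
      B14Cor3.ge_of_sum_repr
        (fun s => (reprOfRecord₁₃ F N θ.toStage13Params P k).χ s U * (reprOfRecord₁₃ F N θ.toStage13Params P k).TexpA s U) (s₀ P k)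
        (densOfRecord₁₃_eq_sum F N θ P k U) (fun s => histTerm_nonneg θ.toStage13Params h.zetaUnity h.zetaAbs P k s U) (hL2small P hP k hk hS U hsmall))

end Row

/-! ## §2. [III] Cor 3 at the Co datum from Theorem 1's conclusion + law (ii) + the UV row + (L2ˢ) -/

section Family

variable (θ : Stage13HParams F N) (h : θ.Provisos₁₃CoPH F N)

open Classical in
/-- **★★ [III] COR. 3 «WITH e±» AT THE RECORD FROM THEOREM 1's CONCLUSION + law (ii) + the expansion-free UV row + (L2ˢ)**: `B16.UVIneq … V (em g_k) (ep g_k)` at EVERY configuration on the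
windowed runs.  CONDITIONAL on `hS`, `hdead`, `hIUV`, (L2ˢ); nothing of Bałaban's asserted. [cite: Balaban1988Convergent, Thm 1 p.262, Cor. 3 (2.50) p.264; Balaban1989LargeFieldI, (0.3) p.176, (ii) p.177] -/
theorem cor3With_datumOfRecord₁₃CoPH_of_iterTransportUV_L2small (hε : 0 < θ.ν.εreg) (hε3 : (143 * ((((4 + 4 : ℕ) : ℝ)) ^ 2 / 4) ^ 2) * θ.ν.εreg ≤ 1 / 3)
    (hε2 : 2 * θ.ν.εreg ≤ 2 * deltaSU (Fin N) / ((((4 + 4) * F.L : ℕ) : ℝ) ^ 2)) (γ : ℝ) (em ep : ℝ → ℝ)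
    (hdead : ∀ (P : B12.RunParams) j, j < P.K → ∀ a : SeqOfRecord F θ.ν θ.τ9.M (gOfRecord₁₃ F N θ.toStage13Params P) P.K (j + 1),
      θ.ppSel P (gOfRecord₁₃ F N θ.toStage13Params P) (j + 1) a ≠ a →
      ∀ V, B15.BasicStep.fibreIntegral (fibOfSeq F θ.ν θ.τ9 P (gOfRecord₁₃ F N θ.toStage13Params P) (j + 1) a)
        (rterm (sliceOfRecord F N θ.ν θ.τ9.M P (gOfRecord₁₃ F N θ.toStage13Params P) (j + 1)
          (slotsTOfRecord F N θ.ν θ.τ9 (EOfRecord₁₃ F N θ.toStage13Params) (wOfRecord₉ F N θ.toStage9Params) θ.ppSel P (gOfRecord₁₃ F N θ.toStage13Params P) (j + 1))) a) V = 0)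
    (hmeas : ∀ (P : B12.RunParams) j, j < P.K → ∀ s : SeqOfRecord F θ.ν θ.τ9.M (gOfRecord₁₃ F N θ.toStage13Params P) P.K j,
      Measurable (fun U => chiSeqOfRecord F N θ.ν θ.τ9.M (gOfRecord₁₃ F N θ.toStage13Params P) P.K j s U *
        slotsOfRecord F N θ.ν θ.τ9 (EOfRecord₁₃ F N θ.toStage13Params) (wOfRecord₉ F N θ.toStage9Params) θ.ppSel P (gOfRecord₁₃ F N θ.toStage13Params P) j s U))
    (hIUV : ∀ P : B12.RunParams, ((datumOfRecord₁₃CoPH F N θ h).C P).flow.InInterval γ P.K → ∀ k, k ≤ P.K → ∀ V : GaugeField (F.P P.K) k (SU N),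
      Nat.rec (motive := fun j => GaugeField (F.P P.K) j (SU N) → ℝ)
        (rhoZeroOfRecord F N P.K (gOfRecord₁₃ F N θ.toStage13Params P 0) (EOfRecord₁₃ F N θ.toStage13Params P))
        (fun j I => transportOfRecord F N P.K j I) k V ≤ Real.exp (ep (gOfRecord₁₃ F N θ.toStage13Params P k) * (Fintype.card (Site (F.P P.K) k) : ℝ)))
    (s₀ : (P : B12.RunParams) → (k : ℕ) → (reprOfRecord₁₃ F N θ.toStage13Params P k).Adm)
    (hS : ∀ P : B12.RunParams, ((datumOfRecord₁₃CoPH F N θ h).C P).flow.InInterval γ P.K → ∀ k, k ≤ P.K → SLaw₁₃CoPH F N θ P k)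
    (hL2small : ∀ P : B12.RunParams, ((datumOfRecord₁₃CoPH F N θ h).C P).flow.InInterval γ P.K → ∀ k, k ≤ P.K → SLaw₁₃CoPH F N θ P k →
      ∀ V : GaugeField (F.P P.K) k (SU N),
        (∀ p : Plaq (F.P P.K) k, ¬ IsB0 (F := F) (⟨p.src, p.μ⟩ : PBond (F.P P.K) k) → ¬ IsB0 (F := F) (⟨p.src.shift p.μ, p.ν⟩ : PBond (F.P P.K) k) →
          ¬ IsB0 (F := F) (⟨p.src.shift p.ν, p.μ⟩ : PBond (F.P P.K) k) → ¬ IsB0 (F := F) (⟨p.src, p.ν⟩ : PBond (F.P P.K) k) →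
          dist1 (GaugeField.plaqHol V p) < 2 * θ.ν.εreg + 4 * θ.ε₂₉) →
        chiβOfRecord₁₃ F N θ.toStage13Params P.K (gOfRecord₁₃ F N θ.toStage13Params P) k V *
            Real.exp (-(1 / (gOfRecord₁₃ F N θ.toStage13Params P k) ^ 2 * wilsonBGOfRecord F N θ.εbg P k V)
              - em (gOfRecord₁₃ F N θ.toStage13Params P k) * (Fintype.card (Site (F.P P.K) k) : ℝ)) ≤
          (reprOfRecord₁₃ F N θ.toStage13Params P k).χ (s₀ P k) V * (reprOfRecord₁₃ F N θ.toStage13Params P k).TexpA (s₀ P k) V) :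
    B16.Cor3With (datumOfRecord₁₃CoPH F N θ h).C γ em ep := by
  intro P hP k hk V
  have hs : SLaw₁₃CoPH F N θ P k := hS P hP k hk
  have hk' : k ≤ (F.P P.K).m + (F.P P.K).K := hk.trans (Nat.le_add_left _ _)
  refine (uvIneq_at_record₁₃CoPH_iff F N θ h P k V _ _).2 ⟨?_, ?_⟩
  · exact uvLower_of_smallLocus θ.toStage13Params h.zetaUnity h.zetaAbs hε P hk' hε3 hε2 _
      (fun U hsmall => B14Cor3.ge_of_sum_repr
        (fun s => (reprOfRecord₁₃ F N θ.toStage13Params P k).χ s U * (reprOfRecord₁₃ F N θ.toStage13Params P k).TexpA s U) (s₀ P k)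
        (densOfRecord₁₃_eq_sum F N θ P k U) (fun s => histTerm_nonneg θ.toStage13Params h.zetaUnity h.zetaAbs P k s U) (hL2small P hP k hk hs U hsmall)) V
  · exact (densOfRecord₁₃_le_iterTransport_of_deadSel F N θ P h k hk
      (fun j hj => hdead P j (lt_of_lt_of_le hj hk)) (fun j hj => ⟨_, fun W => hIUV P hP j (hj.le.trans hk) W⟩)
      (fun j hj => hmeas P j (lt_of_lt_of_le hj hk)) V).trans (hIUV P hP k hk V)

open Classical in
/-- **★★ [III] COR. 3 (`B16.Cor3_250`) AT THE RECORD FROM THEOREM 1 AT THE RECORD + law (ii) + the UV row + (L2ˢ) ON `]0, γ]`** (`min γ γ₁` through `sLaw₁₃CoPH_of_thm1`). CONDITIONAL.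
[cite: Balaban1988Convergent, Cor. 3 (2.50) p.264; Balaban1989LargeFieldII, Thm 1 p.355] -/
theorem cor3_250_datumOfRecord₁₃CoPH_of_thm1_of_iterTransportUV_L2small (hε : 0 < θ.ν.εreg) (hε3 : (143 * ((((4 + 4 : ℕ) : ℝ)) ^ 2 / 4) ^ 2) * θ.ν.εreg ≤ 1 / 3)
    (hε2 : 2 * θ.ν.εreg ≤ 2 * deltaSU (Fin N) / ((((4 + 4) * F.L : ℕ) : ℝ) ^ 2)) (γ : ℝ) (hγ : 0 < γ) (em ep : ℝ → ℝ)
    (hdead : ∀ (P : B12.RunParams) j, j < P.K → ∀ a : SeqOfRecord F θ.ν θ.τ9.M (gOfRecord₁₃ F N θ.toStage13Params P) P.K (j + 1),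
      θ.ppSel P (gOfRecord₁₃ F N θ.toStage13Params P) (j + 1) a ≠ a →
      ∀ V, B15.BasicStep.fibreIntegral (fibOfSeq F θ.ν θ.τ9 P (gOfRecord₁₃ F N θ.toStage13Params P) (j + 1) a)
        (rterm (sliceOfRecord F N θ.ν θ.τ9.M P (gOfRecord₁₃ F N θ.toStage13Params P) (j + 1)
          (slotsTOfRecord F N θ.ν θ.τ9 (EOfRecord₁₃ F N θ.toStage13Params) (wOfRecord₉ F N θ.toStage9Params) θ.ppSel P (gOfRecord₁₃ F N θ.toStage13Params P) (j + 1))) a) V = 0)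
    (hmeas : ∀ (P : B12.RunParams) j, j < P.K → ∀ s : SeqOfRecord F θ.ν θ.τ9.M (gOfRecord₁₃ F N θ.toStage13Params P) P.K j,
      Measurable (fun U => chiSeqOfRecord F N θ.ν θ.τ9.M (gOfRecord₁₃ F N θ.toStage13Params P) P.K j s U *
        slotsOfRecord F N θ.ν θ.τ9 (EOfRecord₁₃ F N θ.toStage13Params) (wOfRecord₉ F N θ.toStage9Params) θ.ppSel P (gOfRecord₁₃ F N θ.toStage13Params P) j s U))
    (hIUV : ∀ P : B12.RunParams, ((datumOfRecord₁₃CoPH F N θ h).C P).flow.InInterval γ P.K → ∀ k, k ≤ P.K → ∀ V : GaugeField (F.P P.K) k (SU N),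
      Nat.rec (motive := fun j => GaugeField (F.P P.K) j (SU N) → ℝ)
        (rhoZeroOfRecord F N P.K (gOfRecord₁₃ F N θ.toStage13Params P 0) (EOfRecord₁₃ F N θ.toStage13Params P))
        (fun j I => transportOfRecord F N P.K j I) k V ≤ Real.exp (ep (gOfRecord₁₃ F N θ.toStage13Params P k) * (Fintype.card (Site (F.P P.K) k) : ℝ)))
    (s₀ : (P : B12.RunParams) → (k : ℕ) → (reprOfRecord₁₃ F N θ.toStage13Params P k).Adm)
    (h1 : B16.Thm1Printed (datumOfRecord₁₃CoPH F N θ h).C)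
    (hL2small : ∀ P : B12.RunParams, ((datumOfRecord₁₃CoPH F N θ h).C P).flow.InInterval γ P.K → ∀ k, k ≤ P.K → SLaw₁₃CoPH F N θ P k →
      ∀ V : GaugeField (F.P P.K) k (SU N),
        (∀ p : Plaq (F.P P.K) k, ¬ IsB0 (F := F) (⟨p.src, p.μ⟩ : PBond (F.P P.K) k) → ¬ IsB0 (F := F) (⟨p.src.shift p.μ, p.ν⟩ : PBond (F.P P.K) k) →
          ¬ IsB0 (F := F) (⟨p.src.shift p.ν, p.μ⟩ : PBond (F.P P.K) k) → ¬ IsB0 (F := F) (⟨p.src, p.ν⟩ : PBond (F.P P.K) k) →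
          dist1 (GaugeField.plaqHol V p) < 2 * θ.ν.εreg + 4 * θ.ε₂₉) →
        chiβOfRecord₁₃ F N θ.toStage13Params P.K (gOfRecord₁₃ F N θ.toStage13Params P) k V *
            Real.exp (-(1 / (gOfRecord₁₃ F N θ.toStage13Params P k) ^ 2 * wilsonBGOfRecord F N θ.εbg P k V)
              - em (gOfRecord₁₃ F N θ.toStage13Params P k) * (Fintype.card (Site (F.P P.K) k) : ℝ)) ≤
          (reprOfRecord₁₃ F N θ.toStage13Params P k).χ (s₀ P k) V * (reprOfRecord₁₃ F N θ.toStage13Params P k).TexpA (s₀ P k) V) :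
    B16.Cor3_250 (datumOfRecord₁₃CoPH F N θ h).C := by
  obtain ⟨γ₁, hγ₁, H1⟩ := sLaw₁₃CoPH_of_thm1 F N θ h h1
  refine ⟨min γ γ₁, lt_min hγ hγ₁, em, ep, ?_⟩
  refine cor3With_datumOfRecord₁₃CoPH_of_iterTransportUV_L2small F N θ h hε hε3 hε2 (min γ γ₁) em ep hdead hmeas ?_ s₀ ?_ ?_
  · exact fun P hP => hIUV P (inInterval_of_le hP (min_le_left γ γ₁))
  · exact fun P hP k hk => H1 P (inInterval_of_le hP (min_le_right γ γ₁)) k hk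
  · exact fun P hP => hL2small P (inInterval_of_le hP (min_le_left γ γ₁))

end Family

/-! ## §3. K1⁷'s LITERAL DATUM `datumOfRecord₁₃SepCoPH θ h`: (B) from Theorem 1 there, and from N11's T-row + the selector laws (the SAME `hdead` twice) -/

section SepCoPH

variable (θ : Stage13HParams F N) (h : θ.Provisos₁₃SepCoPH F N)

open Classical in
/-- **★★★ K1⁷'s (B) CONJUNCT AT ITS LITERAL DATUM FROM THEOREM 1 THERE + law (ii) + the UV row + (L2ˢ)** (a HYPOTHESIS `h1`; §2 at `h.toCore`).  CONDITIONAL; K1⁷ NOT closed.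
[cite: Balaban1989LargeFieldII, Thm 1 p.355, (0.1) pp.355–356; Balaban1988Convergent, Cor. 3 p.264] -/
theorem endStatementBPrinted_datumOfRecord₁₃SepCoPH_of_thm1_of_iterTransportUV_L2small (hε : 0 < θ.ν.εreg) (hε3 : (143 * ((((4 + 4 : ℕ) : ℝ)) ^ 2 / 4) ^ 2) * θ.ν.εreg ≤ 1 / 3)
    (hε2 : 2 * θ.ν.εreg ≤ 2 * deltaSU (Fin N) / ((((4 + 4) * F.L : ℕ) : ℝ) ^ 2)) (γ : ℝ) (hγ : 0 < γ) (em ep : ℝ → ℝ)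
    (hdead : ∀ (P : B12.RunParams) j, j < P.K → ∀ a : SeqOfRecord F θ.ν θ.τ9.M (gOfRecord₁₃ F N θ.toStage13Params P) P.K (j + 1),
      θ.ppSel P (gOfRecord₁₃ F N θ.toStage13Params P) (j + 1) a ≠ a →
      ∀ V, B15.BasicStep.fibreIntegral (fibOfSeq F θ.ν θ.τ9 P (gOfRecord₁₃ F N θ.toStage13Params P) (j + 1) a)
        (rterm (sliceOfRecord F N θ.ν θ.τ9.M P (gOfRecord₁₃ F N θ.toStage13Params P) (j + 1)
          (slotsTOfRecord F N θ.ν θ.τ9 (EOfRecord₁₃ F N θ.toStage13Params) (wOfRecord₉ F N θ.toStage9Params) θ.ppSel P (gOfRecord₁₃ F N θ.toStage13Params P) (j + 1))) a) V = 0)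
    (hmeas : ∀ (P : B12.RunParams) j, j < P.K → ∀ s : SeqOfRecord F θ.ν θ.τ9.M (gOfRecord₁₃ F N θ.toStage13Params P) P.K j,
      Measurable (fun U => chiSeqOfRecord F N θ.ν θ.τ9.M (gOfRecord₁₃ F N θ.toStage13Params P) P.K j s U *
        slotsOfRecord F N θ.ν θ.τ9 (EOfRecord₁₃ F N θ.toStage13Params) (wOfRecord₉ F N θ.toStage9Params) θ.ppSel P (gOfRecord₁₃ F N θ.toStage13Params P) j s U))
    (hIUV : ∀ P : B12.RunParams, ((datumOfRecord₁₃SepCoPH F N θ h).C P).flow.InInterval γ P.K → ∀ k, k ≤ P.K → ∀ V : GaugeField (F.P P.K) k (SU N),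
      Nat.rec (motive := fun j => GaugeField (F.P P.K) j (SU N) → ℝ)
        (rhoZeroOfRecord F N P.K (gOfRecord₁₃ F N θ.toStage13Params P 0) (EOfRecord₁₃ F N θ.toStage13Params P))
        (fun j I => transportOfRecord F N P.K j I) k V ≤ Real.exp (ep (gOfRecord₁₃ F N θ.toStage13Params P k) * (Fintype.card (Site (F.P P.K) k) : ℝ)))
    (s₀ : (P : B12.RunParams) → (k : ℕ) → (reprOfRecord₁₃ F N θ.toStage13Params P k).Adm)
    (h1 : B16.Thm1Printed (datumOfRecord₁₃SepCoPH F N θ h).C)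
    (hL2small : ∀ P : B12.RunParams, ((datumOfRecord₁₃SepCoPH F N θ h).C P).flow.InInterval γ P.K → ∀ k, k ≤ P.K → SLaw₁₃CoPH F N θ P k →
      ∀ V : GaugeField (F.P P.K) k (SU N),
        (∀ p : Plaq (F.P P.K) k, ¬ IsB0 (F := F) (⟨p.src, p.μ⟩ : PBond (F.P P.K) k) → ¬ IsB0 (F := F) (⟨p.src.shift p.μ, p.ν⟩ : PBond (F.P P.K) k) →
          ¬ IsB0 (F := F) (⟨p.src.shift p.ν, p.μ⟩ : PBond (F.P P.K) k) → ¬ IsB0 (F := F) (⟨p.src, p.ν⟩ : PBond (F.P P.K) k) →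
          dist1 (GaugeField.plaqHol V p) < 2 * θ.ν.εreg + 4 * θ.ε₂₉) →
        chiβOfRecord₁₃ F N θ.toStage13Params P.K (gOfRecord₁₃ F N θ.toStage13Params P) k V *
            Real.exp (-(1 / (gOfRecord₁₃ F N θ.toStage13Params P k) ^ 2 * wilsonBGOfRecord F N θ.εbg P k V)
              - em (gOfRecord₁₃ F N θ.toStage13Params P k) * (Fintype.card (Site (F.P P.K) k) : ℝ)) ≤
          (reprOfRecord₁₃ F N θ.toStage13Params P k).χ (s₀ P k) V * (reprOfRecord₁₃ F N θ.toStage13Params P k).TexpA (s₀ P k) V) :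
    B16.EndStatementBPrinted (datumOfRecord₁₃SepCoPH F N θ h).C :=
  ⟨h1, cor3_250_datumOfRecord₁₃CoPH_of_thm1_of_iterTransportUV_L2small F N θ h.toCore hε hε3 hε2 γ hγ em ep hdead hmeas hIUV s₀ h1 hL2small⟩

open Classical in
/-- **★★★ WHAT K1⁷'s (B) CONJUNCT COSTS AT ITS LITERAL DATUM, THIRD PRICING**: admissibility ∧ signs ∧ the tree's selector laws (i) `hidem`, (ii) `hdead` ∧ N11's T-ROW on `]0, γ]` (⟹ Theorem 1, p583899)
∧ measurability of the history terms ∧ ONE analytic row — the expansion-free UV bound `hIUV` on the iterated transport of `ρ₀` (LOCATED: not print's d = 4 theorem) ∧ (L2ˢ) ∧ `hε hε3 hε2`; `hdead`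
serves BOTH Theorem 1's 𝐑-leaf and the upper half.  CONDITIONAL; K1⁷ NOT closed; nothing of Bałaban's asserted. [cite: Balaban1989LargeFieldII, Thm 1 p.355, p.391; Balaban1988Convergent, p.245, Thm 1 p.262, Cor. 3 p.264; Balaban1989LargeFieldI, (0.3) p.176, (i)–(ii) p.177] -/
theorem endStatementBPrinted_datumOfRecord₁₃SepCoPH_of_tRow_selLaws_iterTransportUV_L2small (hθ : θ.Admissible F N) (hκ : 0 ≤ θ.s2.lf.κ) (hE₀ : 0 ≤ θ.s2.lf.E₀)
    (hB₀ : 0 ≤ θ.s2.lf.B₀) (hε : 0 < θ.ν.εreg) (hε3 : (143 * ((((4 + 4 : ℕ) : ℝ)) ^ 2 / 4) ^ 2) * θ.ν.εreg ≤ 1 / 3)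
    (hε2 : 2 * θ.ν.εreg ≤ 2 * deltaSU (Fin N) / ((((4 + 4) * F.L : ℕ) : ℝ) ^ 2)) (γ : ℝ) (hγ : 0 < γ) (em ep : ℝ → ℝ)
    (hidem : ∀ (P : B12.RunParams) k, k < P.K → ∀ a, θ.ppSel P (gOfRecord₁₃ F N θ.toStage13Params P) (k + 1) (θ.ppSel P (gOfRecord₁₃ F N θ.toStage13Params P) (k + 1) a)
      = θ.ppSel P (gOfRecord₁₃ F N θ.toStage13Params P) (k + 1) a)
    (hdead : ∀ (P : B12.RunParams) j, j < P.K → ∀ a : SeqOfRecord F θ.ν θ.τ9.M (gOfRecord₁₃ F N θ.toStage13Params P) P.K (j + 1),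
      θ.ppSel P (gOfRecord₁₃ F N θ.toStage13Params P) (j + 1) a ≠ a →
      ∀ V, B15.BasicStep.fibreIntegral (fibOfSeq F θ.ν θ.τ9 P (gOfRecord₁₃ F N θ.toStage13Params P) (j + 1) a)
        (rterm (sliceOfRecord F N θ.ν θ.τ9.M P (gOfRecord₁₃ F N θ.toStage13Params P) (j + 1)
          (slotsTOfRecord F N θ.ν θ.τ9 (EOfRecord₁₃ F N θ.toStage13Params) (wOfRecord₉ F N θ.toStage9Params) θ.ppSel P (gOfRecord₁₃ F N θ.toStage13Params P) (j + 1))) a) V = 0)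
    (hmeas : ∀ (P : B12.RunParams) j, j < P.K → ∀ s : SeqOfRecord F θ.ν θ.τ9.M (gOfRecord₁₃ F N θ.toStage13Params P) P.K j,
      Measurable (fun U => chiSeqOfRecord F N θ.ν θ.τ9.M (gOfRecord₁₃ F N θ.toStage13Params P) P.K j s U *
        slotsOfRecord F N θ.ν θ.τ9 (EOfRecord₁₃ F N θ.toStage13Params) (wOfRecord₉ F N θ.toStage9Params) θ.ppSel P (gOfRecord₁₃ F N θ.toStage13Params P) j s U))
    (hIUV : ∀ P : B12.RunParams, ((datumOfRecord₁₃SepCoPH F N θ h).C P).flow.InInterval γ P.K → ∀ k, k ≤ P.K → ∀ V : GaugeField (F.P P.K) k (SU N),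
      Nat.rec (motive := fun j => GaugeField (F.P P.K) j (SU N) → ℝ)
        (rhoZeroOfRecord F N P.K (gOfRecord₁₃ F N θ.toStage13Params P 0) (EOfRecord₁₃ F N θ.toStage13Params P))
        (fun j I => transportOfRecord F N P.K j I) k V ≤ Real.exp (ep (gOfRecord₁₃ F N θ.toStage13Params P k) * (Fintype.card (Site (F.P P.K) k) : ℝ)))
    (s₀ : (P : B12.RunParams) → (k : ℕ) → (reprOfRecord₁₃ F N θ.toStage13Params P k).Adm)
    (hT : ∀ P : B12.RunParams, ((datumOfRecord₁₃SepCoPH F N θ h).C P).flow.InInterval γ P.K →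
      ∀ k, k < P.K → SLaw₁₃CoPH F N θ P k → TLaw₁₃CoPH F N θ P k)
    (hL2small : ∀ P : B12.RunParams, ((datumOfRecord₁₃SepCoPH F N θ h).C P).flow.InInterval γ P.K → ∀ k, k ≤ P.K → SLaw₁₃CoPH F N θ P k →
      ∀ V : GaugeField (F.P P.K) k (SU N),
        (∀ p : Plaq (F.P P.K) k, ¬ IsB0 (F := F) (⟨p.src, p.μ⟩ : PBond (F.P P.K) k) → ¬ IsB0 (F := F) (⟨p.src.shift p.μ, p.ν⟩ : PBond (F.P P.K) k) →
          ¬ IsB0 (F := F) (⟨p.src.shift p.ν, p.μ⟩ : PBond (F.P P.K) k) → ¬ IsB0 (F := F) (⟨p.src, p.ν⟩ : PBond (F.P P.K) k) →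
          dist1 (GaugeField.plaqHol V p) < 2 * θ.ν.εreg + 4 * θ.ε₂₉) →
        chiβOfRecord₁₃ F N θ.toStage13Params P.K (gOfRecord₁₃ F N θ.toStage13Params P) k V *
            Real.exp (-(1 / (gOfRecord₁₃ F N θ.toStage13Params P k) ^ 2 * wilsonBGOfRecord F N θ.εbg P k V)
              - em (gOfRecord₁₃ F N θ.toStage13Params P k) * (Fintype.card (Site (F.P P.K) k) : ℝ)) ≤
          (reprOfRecord₁₃ F N θ.toStage13Params P k).χ (s₀ P k) V * (reprOfRecord₁₃ F N θ.toStage13Params P k).TexpA (s₀ P k) V) :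
    B16.EndStatementBPrinted (datumOfRecord₁₃SepCoPH F N θ h).C :=
  endStatementBPrinted_datumOfRecord₁₃SepCoPH_of_thm1_of_iterTransportUV_L2small F N θ h hε hε3 hε2 γ hγ em ep hdead hmeas hIUV s₀
    (thm1Printed_datumOfRecord₁₃SepCoPH_of_laws_of_selLaws F N θ h hθ hκ hE₀ hB₀ hγ hidem hdead hT) hL2small

end SepCoPH

/-! ## §4. N13's DAG NODE `Dag.B16_main (leavesP w P)` — the N13 entry of K1⁷ v6 stub 1's `Nodes (leavesP w P)` — third pricing -/

section Node

variable (θ : Stage13HParams F N) (w : WorldP) (P : B12.RunParams) (h : θ.Provisos₁₃CoPH F N)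

open Classical in
/-- **★★★ N13's NODE PREDICATE AT A WORLD BOUND TO THE STAGE-13 RECORD, THIRD PRICING**: for `w.C = (datumOfRecord₁₃CoPH θ h).C` and `w.up P = upOfRecord₅C … P`, `Dag.B16_main (leavesP w P)` ⟸
admissibility ∧ signs ∧ the tree's selector laws (i)(ii) (for every run; (R₁₃) by p583899's `laws₁₃CoPH_of_selLaws_coPH`) ∧ measurability of the history terms ∧ the EXPANSION-FREE UV ROW `hIUV`
«`I_k ≤ exp(w.ep(g_k)|T₁^{(k)}|)` at every field on the windowed runs» ∧ (L2ˢ) ∧ `hε hε3 hε2` ((UV₁₃) by §1 at `γ₁ := w.γ`).  READING: at the parameters the node files cover, [B16] Thm 1 ∕ [III] Cor. 3's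
upper half enter N13's node ONLY as UV stability of the block-averaged Gibbs density (`hIUV`), [III] Thm 2 only through (L2ˢ); `hIUV` is not what print proves in d = 4 (the history-mixing 𝐑
of [IV] is not exercised under law (ii)).  CONDITIONAL on the displayed inputs; N13 NOT discharged; nothing of Bałaban's asserted or refuted.
[cite: Balaban1989LargeFieldII, Thm 1 p.355, (0.1) pp.355–356; Balaban1988Convergent, p.244, Cor. 3 p.264, (3.1) p.264; Balaban1989LargeFieldI, abstract, p.175, (0.3) p.176, (i)–(ii) p.177] -/
theorem b16_main_at_record₁₃CoPH_of_selLaws_iterTransportUV_L2small (hC : w.C = (datumOfRecord₁₃CoPH F N θ h).C)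
    (hup : w.up P = upOfRecord₅C F N (θ.toStage5₁₃CoPH F N) P) (hθ : θ.Admissible F N) (hκ : 0 ≤ θ.s2.lf.κ) (hE₀ : 0 ≤ θ.s2.lf.E₀) (hB₀ : 0 ≤ θ.s2.lf.B₀)
    (hidem : ∀ (P : B12.RunParams) k, k < P.K → ∀ a, θ.ppSel P (gOfRecord₁₃ F N θ.toStage13Params P) (k + 1) (θ.ppSel P (gOfRecord₁₃ F N θ.toStage13Params P) (k + 1) a)
      = θ.ppSel P (gOfRecord₁₃ F N θ.toStage13Params P) (k + 1) a)
    (hε : 0 < θ.ν.εreg) (hε3 : (143 * ((((4 + 4 : ℕ) : ℝ)) ^ 2 / 4) ^ 2) * θ.ν.εreg ≤ 1 / 3)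
    (hε2 : 2 * θ.ν.εreg ≤ 2 * deltaSU (Fin N) / ((((4 + 4) * F.L : ℕ) : ℝ) ^ 2))
    (hdead : ∀ (P : B12.RunParams) j, j < P.K → ∀ a : SeqOfRecord F θ.ν θ.τ9.M (gOfRecord₁₃ F N θ.toStage13Params P) P.K (j + 1),
      θ.ppSel P (gOfRecord₁₃ F N θ.toStage13Params P) (j + 1) a ≠ a →
      ∀ V, B15.BasicStep.fibreIntegral (fibOfSeq F θ.ν θ.τ9 P (gOfRecord₁₃ F N θ.toStage13Params P) (j + 1) a)
        (rterm (sliceOfRecord F N θ.ν θ.τ9.M P (gOfRecord₁₃ F N θ.toStage13Params P) (j + 1)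
          (slotsTOfRecord F N θ.ν θ.τ9 (EOfRecord₁₃ F N θ.toStage13Params) (wOfRecord₉ F N θ.toStage9Params) θ.ppSel P (gOfRecord₁₃ F N θ.toStage13Params P) (j + 1))) a) V = 0)
    (hmeas : ∀ (P : B12.RunParams) j, j < P.K → ∀ s : SeqOfRecord F θ.ν θ.τ9.M (gOfRecord₁₃ F N θ.toStage13Params P) P.K j,
      Measurable (fun U => chiSeqOfRecord F N θ.ν θ.τ9.M (gOfRecord₁₃ F N θ.toStage13Params P) P.K j s U *
        slotsOfRecord F N θ.ν θ.τ9 (EOfRecord₁₃ F N θ.toStage13Params) (wOfRecord₉ F N θ.toStage9Params) θ.ppSel P (gOfRecord₁₃ F N θ.toStage13Params P) j s U))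
    (hIUV : ∀ P : B12.RunParams, (genFlow (betaOfRecord₁₃ F N θ.toStage13Params) P.g0).InInterval w.γ P.K → ∀ k, k ≤ P.K → ∀ V : GaugeField (F.P P.K) k (SU N),
      Nat.rec (motive := fun j => GaugeField (F.P P.K) j (SU N) → ℝ)
        (rhoZeroOfRecord F N P.K (gOfRecord₁₃ F N θ.toStage13Params P 0) (EOfRecord₁₃ F N θ.toStage13Params P))
        (fun j I => transportOfRecord F N P.K j I) k V ≤ Real.exp (w.ep (gOfRecord₁₃ F N θ.toStage13Params P k) * (Fintype.card (Site (F.P P.K) k) : ℝ)))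
    (s₀ : (P : B12.RunParams) → (k : ℕ) → (reprOfRecord₁₃ F N θ.toStage13Params P k).Adm)
    (hL2small : ∀ P : B12.RunParams, (genFlow (betaOfRecord₁₃ F N θ.toStage13Params) P.g0).InInterval w.γ P.K → ∀ k, k ≤ P.K → SLaw₁₃CoPH F N θ P k →
      ∀ V : GaugeField (F.P P.K) k (SU N),
        (∀ p : Plaq (F.P P.K) k, ¬ IsB0 (F := F) (⟨p.src, p.μ⟩ : PBond (F.P P.K) k) → ¬ IsB0 (F := F) (⟨p.src.shift p.μ, p.ν⟩ : PBond (F.P P.K) k) →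
          ¬ IsB0 (F := F) (⟨p.src.shift p.ν, p.μ⟩ : PBond (F.P P.K) k) → ¬ IsB0 (F := F) (⟨p.src, p.ν⟩ : PBond (F.P P.K) k) →
          dist1 (GaugeField.plaqHol V p) < 2 * θ.ν.εreg + 4 * θ.ε₂₉) →
        chiβOfRecord₁₃ F N θ.toStage13Params P.K (gOfRecord₁₃ F N θ.toStage13Params P) k V *
            Real.exp (-(1 / (gOfRecord₁₃ F N θ.toStage13Params P k) ^ 2 * wilsonBGOfRecord F N θ.εbg P k V)
              - w.em (gOfRecord₁₃ F N θ.toStage13Params P k) * (Fintype.card (Site (F.P P.K) k) : ℝ)) ≤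
          (reprOfRecord₁₃ F N θ.toStage13Params P k).χ (s₀ P k) V * (reprOfRecord₁₃ F N θ.toStage13Params P k).TexpA (s₀ P k) V) :
    Dag.B16_main (DagBinding.leavesP w P) :=
  B16NodeKnitRecord13CoPH.b16_main_at_record₁₃CoPH F N θ w P h hC hup
    (B16RLeafRecord13SepCoPHSelLaws.laws₁₃CoPH_of_selLaws_coPH F N θ P h hθ hκ hE₀ hB₀ (fun k hk a => hidem P k hk a) (fun k hk a => hdead P k hk a)) le_rfl
    (hUV₁₃CoPH_of_iterTransportUV_L2small F N θ w h hε hε3 hε2 hdead hmeas hIUV s₀ hL2small P)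

end Node

end Summit.QuantumFields.YangMills.BalabanUVNodes.N13NodeOfIteratedTransportUVAtRecord13SepCoPH

end
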